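import Mathlib
import Summits.Ventures.HodgeRepro.OcticCMPointSixModel
import Summits.Ventures.HodgeRepro.OcticCMPointEightSign

/-!
# OcticCMPointSixSign — the conductor-`6` root numbers at `𝔭 | 5` of the octic point

Blind re-derivation cell `pub-hodge-repro`, seat night-2 (gen 5).  Target tree path
`lean/Summits/Ventures/HodgeRepro/OcticCMPointSixSign.lean`.  On `R6 = 𝒪/𝔭⁶ = R8 ⧸ (5w²)` of
`OcticCMPointSixModel.lean` (the descended conjugation `σ₆`, the primitive `σ`-odd `ψ̃₆(ȳ) = ψ̃₈(w² y)`, the ideal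
`I₆ = q((w³))` with `I₆ · I₆ = 0` and `ψ̃₆`-annihilator `I₆`):

* **The `σ`-fixed representative.**  `σ₆(ā) ≡ ā` mod `I₆` means `σ(a) − a ∈ (w³)` in `R8` (`J ⊆ (w³)`), whose
  `w`-coordinate `−2c₁` lies in `5ℤ/25`, so `c₁ w ∈ 5R8 ⊆ (w³)` (`5 = w³(w³ − w)`) and `ā ≡ q(evenPart a)` mod `I₆`
  (`sub_evenPart_mem_I6`); `q(evenPart a)` is `σ₆`-fixed with `ψ̃₆ = 1` (`top(w² (c₀ + c₂w²)) = 0`).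
* **`eps_six`**: for EVERY conjugate-dual character `ρ` of `(𝒪/𝔭⁶)^×` of conductor exactly `6` (`ρ(1 + z) = ψ̃₆(a z)`
  on `I₆`, `a` a unit) and `κ` with `κ |I₆| = 1`: `ε(½, ρ, ψ̃₆) = ρ(ϖ)^n · ρ(a₀)^{−1}` with `a₀` a `σ₆`-fixed unit
  `≡ a` mod `I₆` and `ρ(a₀)² = 1` — the conductor-`6` row of the table, of the same shape as `c = 2, 4, 8`;
  `eps_six_of_trivial` (`ε = ρ(ϖ)^n` for `ρ` trivial on the `σ₆`-fixed units), `E3_six`.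

REMARK.  `|I₆| = 125 = |𝒪/𝔭⁶|^{1/2}` (numerics/six_model.py: `|(w³)/J| = 125`) is not formalised; the statements
carry `κ` with `κ |I₆| = 1`, which is Kudla's `κ = |R|^{−1/2}`.

**What this is not.**  Conductors `5` and `7` (odd) and the four `χ′_j` of the face are NOT here.  Nothing here says
anything about the status of the Hodge conjecture for CM abelian varieties, which is NOT proved.
-/

set_option autoImplicit false

noncomputable section

open Polynomial Classical

namespace Summit.Ventures.HodgeRepro.PeriodCloser

namespace SixModel

open GaussSumStability EightModel

/-! ### `(w³) ⊇ 5R8 ⊇ J`, and the `w`-coordinate of an element of `(w³)` -/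

/-- `5 = w³ (w³ − w)`. -/
theorem five_eq : (5 : R8) = w ^ 3 * (w ^ 3 - w) := by
  have hrel := w_rel
  have h6 := w_pow_six
  have h25 := twentyfive_eq_zero
  linear_combination hrel - h6 - w ^ 2 * h25

/-- The ideal `(w³)` of `R8`. -/
def W3 : Ideal R8 := Ideal.span {w ^ 3}

/-- `y ∈ (w³) ↔ y = w³ b`. -/
theorem mem_W3_iff (y : R8) : y ∈ W3 ↔ ∃ b, y = w ^ 3 * b := by
  rw [W3, Ideal.mem_span_singleton']
  constructor
  · rintro ⟨b, hb⟩
    exact ⟨b, by rw [← hb, mul_comm]⟩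
  · rintro ⟨b, hb⟩
    exact ⟨b, by rw [hb, mul_comm]⟩

/-- `5 y ∈ (w³)`. -/
theorem five_mul_mem_W3 (y : R8) : 5 * y ∈ W3 :=
  (mem_W3_iff _).2 ⟨(w ^ 3 - w) * y, by rw [five_eq]; ring⟩

/-- `J ⊆ (w³)`. -/
theorem J_le_W3 (y : R8) (hy : y ∈ J) : y ∈ W3 := by
  obtain ⟨b, rfl⟩ := (mem_J_iff y).1 hy
  rw [show (5 : R8) * w ^ 2 * b = 5 * (w ^ 2 * b) by ring]
  exact five_mul_mem_W3 _

/-- `q y ∈ I₆ ↔ y ∈ (w³)` (as `J ⊆ (w³)`). -/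
theorem q_mem_I6_iff (y : R8) : q y ∈ I6 ↔ y ∈ W3 := by
  rw [mem_I6_iff, mem_W3_iff]
  constructor
  · rintro ⟨b, hb⟩
    have : y - w ^ 3 * b ∈ J := by
      rw [← Ideal.Quotient.eq]
      exact hb
    obtain ⟨c, hc⟩ := (mem_J_iff _).1 this
    refine ⟨b + (w ^ 3 - w) * (w ^ 2 * c), ?_⟩
    have h5 := five_eq
    linear_combination hc + (w ^ 2 * c) * h5
  · rintro ⟨b, rfl⟩
    exact ⟨b, rfl⟩

/-- **`w³ a` in coordinates**: the `w`-coordinate of `w³ a` is `20 c₂`. -/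
theorem w_cube_mul_comb (c₀ c₁ c₂ c₃ : ZMod 25) :
    w ^ 3 * (c₀ • (1 : R8) + c₁ • w + c₂ • w ^ 2 + c₃ • w ^ 3) =
      (20 * c₁) • (1 : R8) + (20 * c₂) • w + (20 * c₁ + 20 * c₃) • w ^ 2 + (c₀ + 20 * c₂) • w ^ 3 := by
  have h4 := w_pow_four
  have h5 := w_pow_five
  have h6 := w_pow_six
  have h20 : algebraMap (ZMod 25) R8 20 = 20 := map_ofNat _ _
  simp only [smul_eq_num, map_add, map_mul, h20]
  linear_combination (algebraMap (ZMod 25) R8 c₁) * h4 + (algebraMap (ZMod 25) R8 c₂) * h5 +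
    (algebraMap (ZMod 25) R8 c₃) * h6

/-- The `w`-coordinate of an element of `(w³)` lies in `5ℤ/25`. -/
theorem coord_one_of_mem_W3 {y : R8} (hy : y ∈ W3) : ∃ d : ZMod 25, b4.repr y 1 = 5 * d := by
  obtain ⟨b, rfl⟩ := (mem_W3_iff y).1 hy
  rw [eq_comb b, w_cube_mul_comb, coords_comb]
  exact eq_five_mul_of_twenty_mul_eq_zero _ (by
    have : ∀ c : ZMod 25, 20 * (20 * c) = 0 := by decide
    exact this _)

/-- `2c ∈ 5ℤ/25` forces `c ∈ 5ℤ/25`. -/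
theorem eq_five_mul_of_two_mul (c d : ZMod 25) (h : 2 * c = 5 * d) : ∃ d', c = 5 * d' := by
  revert c d; decide

/-! ### The `σ`-fixed representative mod `I₆` -/

/-- **`σ₆(q a) ≡ q a` mod `I₆` forces `q a ≡ q(evenPart a)` mod `I₆`**: `σ(a) − a = −2 (c₁w + c₃w³) ∈ (w³)`,
so `2c₁ ∈ 5ℤ/25`, `c₁ ∈ 5ℤ/25`, and `c₁ w ∈ 5R8 ⊆ (w³)`. -/
theorem sub_evenPart_mem_I6 (a : R8) (h : conj6 (q a) - q a ∈ I6) : q a - q (evenPart a) ∈ I6 := by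
  rw [conj6_q, ← map_sub, q_mem_I6_iff] at h
  rw [← map_sub, q_mem_I6_iff]
  have hodd : a - evenPart a = oddPart a :=
    (eq_sub_of_add_eq (by rw [add_comm]; exact evenPart_add_oddPart a)).symm
  rw [hodd]
  -- `conj a − a = −(2 · oddPart a)`; subtract the `w³`-part
  rw [conj_sub_self] at h
  have h2 : 2 * oddPart a ∈ W3 := (W3.neg_mem_iff).1 h
  unfold oddPart at h2 ⊢
  have hc3 : (b4.repr a 3) • w ^ 3 ∈ W3 := (mem_W3_iff _).2 ⟨algebraMap (ZMod 25) R8 (b4.repr a 3), by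
    rw [smul_eq_num]; ring⟩
  have h1 : (2 * b4.repr a 1) • w ∈ W3 := by
    have : (2 * b4.repr a 1) • w = 2 * (b4.repr a 1 • w + b4.repr a 3 • w ^ 3) - 2 * (b4.repr a 3 • w ^ 3) := by
      simp only [smul_eq_num, map_mul, map_ofNat]; ring
    rw [this]
    exact W3.sub_mem h2 (W3.mul_mem_left 2 hc3)
  obtain ⟨d, hd⟩ := coord_one_of_mem_W3 h1
  rw [show (2 * b4.repr a 1) • w = (0 : ZMod 25) • (1 : R8) + (2 * b4.repr a 1) • w + (0 : ZMod 25) • w ^ 2 +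
    (0 : ZMod 25) • w ^ 3 by simp, coords_comb] at hd
  obtain ⟨d', hd'⟩ := eq_five_mul_of_two_mul _ _ hd
  refine W3.add_mem ?_ hc3
  rw [hd', mul_smul, show (5 : ZMod 25) • (d' • w) = 5 * (d' • w) by rw [smul_eq_num, map_ofNat]]
  exact five_mul_mem_W3 _

/-- `σ₆` fixes `q(evenPart a)`. -/
theorem conj6_q_evenPart (a : R8) : conj6 (q (evenPart a)) = q (evenPart a) := by
  rw [conj6_q, conj_evenPart]

/-- `ψ̃₆(q(evenPart a)) = 1`: `w² (c₀ + c₂ w²) = c₀ w² + c₂ (20 + 20 w²)` has top coefficient `0`. -/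
theorem psi6_q_evenPart (a : R8) : psi6 (q (evenPart a)) = 1 := by
  rw [psi6_q, psiTilde_apply]
  have h4 := w_pow_four
  have : w ^ 2 * evenPart a = (20 * b4.repr a 2) • (1 : R8) + (0 : ZMod 25) • w + (b4.repr a 0 + 20 * b4.repr a 2) • w ^ 2 +
      (0 : ZMod 25) • w ^ 3 := by
    unfold evenPart
    have h20 : algebraMap (ZMod 25) R8 20 = 20 := map_ofNat _ _
    simp only [smul_eq_num, map_add, map_mul, map_zero, h20]
    linear_combination (algebraMap (ZMod 25) R8 (b4.repr a 2)) * h4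
  rw [this, top_comb, AddChar.map_zero_eq_one]

/-- A unit of `R6` congruent mod `I₆` to `x₀` makes `x₀` a unit (`I₆ · I₆ = 0`). -/
theorem isUnit_of_sub_mem_I6 (a : R6ˣ) (a₀ : R6) (h : (a : R6) - a₀ ∈ I6) : IsUnit a₀ := by
  have hz : ((a⁻¹ : R6ˣ) : R6) * ((a : R6) - a₀) ∈ I6 := I6.mul_mem_left _ h
  have ho2 : (((a⁻¹ : R6ˣ) : R6) * ((a : R6) - a₀)) * (((a⁻¹ : R6ˣ) : R6) * ((a : R6) - a₀)) = 0 := I6_sq _ hz _ hz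
  have hinv := Units.mul_inv a
  have heq : a₀ = (a : R6) * (1 - ((a⁻¹ : R6ˣ) : R6) * ((a : R6) - a₀)) := by
    linear_combination ((a : R6) - a₀) * hinv
  rw [heq]
  refine a.isUnit.mul (IsUnit.of_mul_eq_one (1 + ((a⁻¹ : R6ˣ) : R6) * ((a : R6) - a₀)) ?_)
  linear_combination -ho2

/-! ### The conductor-`6` root numbers -/

/-- **A conductor-`6` character exists** for every `a` (gen 1's extension theorem). -/
theorem exists_primitive_six (a : R6) : ∃ ρ : MulChar R6 ℂ, ∀ z ∈ I6, ρ (1 + z) = psi6 (a * z) :=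
  exists_primitive_mulChar psi6 I6 I6_sq a

/-- **The conductor-`6` root number at `𝔭 | 5` of a conjugate-dual character**: for `ρ` with `ρ ∘ σ₆ = ρ⁻¹` on the
units and `ρ(1 + z) = ψ̃₆(a z)` on `I₆ = 𝔭³/𝔭⁶` (`a` a unit: conductor exactly `6`), and `κ |I₆| = 1`, there is a
`σ₆`-fixed unit `a₀ ≡ a` mod `I₆` with `ρ(a₀)² = 1` and `ε(½, ρ, ψ̃₆) = ρ(ϖ)^n · ρ(a₀)^{−1}`. -/
theorem eps_six (n : ℕ) (ρ : LocalChar R6) (hσ : ∀ x, ρ.unit (conj6 x) = ρ.unit⁻¹ x) (a : R6ˣ)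
    (hρ : LocalChar.Primitive psi6 I6 ρ a) (κ : ℂ) (hκ : κ * (Fintype.card I6 : ℂ) = 1) :
    ∃ a₀ : R6ˣ, conj6 (a₀ : R6) = a₀ ∧ (a : R6) - a₀ ∈ I6 ∧ ρ.unit (a₀ : R6) * ρ.unit (a₀ : R6) = 1 ∧
      LocalChar.eps κ n ρ psi6 = ρ.piVal ^ n * (ρ.unit (a₀ : R6))⁻¹ := by
  have hconj : conj6 (a : R6) - a ∈ I6 :=
    LocalChar.conj_sub_mem psi6 I6 psiAnn_I6_iff conj6 conj6_conj6 conj6_mem_I6 psi6_conj6 ρ hσ a hρ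
  obtain ⟨a', ha'⟩ := q_surjective (a : R6)
  rw [← ha'] at hconj
  have hsub := sub_evenPart_mem_I6 a' hconj
  rw [ha'] at hsub
  have hu := isUnit_of_sub_mem_I6 a _ hsub
  obtain ⟨h1, h2, -⟩ := LocalChar.eps_eq_of_conjDual κ n ρ psi6 I6 I6_sq psiAnn_I6_iff conj6 hσ psi6_conj6 a hρ hκ
    hu.unit (by rw [IsUnit.unit_spec]; exact conj6_q_evenPart a') (by rw [IsUnit.unit_spec]; exact hsub)
  refine ⟨hu.unit, ?_, ?_, h2, ?_⟩
  · rw [IsUnit.unit_spec]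
    exact conj6_q_evenPart a'
  · rw [IsUnit.unit_spec]
    exact hsub
  · rw [h1, IsUnit.unit_spec, psi6_q_evenPart, mul_one]

/-- `ε(½, ρ, ψ̃₆) = ρ(ϖ)^n` for a conjugate-dual `ρ` of conductor exactly `6` trivial on the `σ₆`-fixed units. -/
theorem eps_six_of_trivial (n : ℕ) (ρ : LocalChar R6) (hσ : ∀ x, ρ.unit (conj6 x) = ρ.unit⁻¹ x)
    (hfix : ∀ u : R6ˣ, conj6 (u : R6) = u → ρ.unit (u : R6) = 1) (a : R6ˣ)
    (hρ : LocalChar.Primitive psi6 I6 ρ a) (κ : ℂ) (hκ : κ * (Fintype.card I6 : ℂ) = 1) :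
    LocalChar.eps κ n ρ psi6 = ρ.piVal ^ n := by
  obtain ⟨a₀, hσa₀, -, -, heps⟩ := eps_six n ρ hσ a hρ κ hκ
  rw [heps, hfix a₀ hσa₀, inv_one, mul_one]

/-- **(E3) at `𝔭 | 5`, conductor `6`, for four conjugate-dual lines trivial on the `σ₆`-fixed units** is the
`ϖ`-part of N2. -/
theorem E3_six (n : ℕ) (ρ : Fin 4 → LocalChar R6) (hσ : ∀ j x, (ρ j).unit (conj6 x) = (ρ j).unit⁻¹ x)
    (hfix : ∀ j (u : R6ˣ), conj6 (u : R6) = u → (ρ j).unit (u : R6) = 1) (a : Fin 4 → R6ˣ)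
    (hρ : ∀ j, LocalChar.Primitive psi6 I6 (ρ j) (a j)) (κ : ℂ) (hκ : κ * (Fintype.card I6 : ℂ) = 1)
    (hN2 : (ρ 0).piVal * (ρ 1).piVal = (ρ 2).piVal * (ρ 3).piVal) :
    LocalChar.eps κ n (ρ 0) psi6 * LocalChar.eps κ n (ρ 1) psi6 =
      LocalChar.eps κ n (ρ 2) psi6 * LocalChar.eps κ n (ρ 3) psi6 := by
  rw [eps_six_of_trivial n (ρ 0) (hσ 0) (hfix 0) (a 0) (hρ 0) κ hκ, eps_six_of_trivial n (ρ 1) (hσ 1) (hfix 1) (a 1) (hρ 1) κ hκ,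
    eps_six_of_trivial n (ρ 2) (hσ 2) (hfix 2) (a 2) (hρ 2) κ hκ, eps_six_of_trivial n (ρ 3) (hσ 3) (hfix 3) (a 3) (hρ 3) κ hκ,
    ← mul_pow, hN2, mul_pow]

end SixModel

end Summit.Ventures.HodgeRepro.PeriodCloser

end
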